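import Summits.CriticalPhenomena.PercolationContinuityZ3.Theorems.PercNearOneGluingNoHeavyLowerTailQ44IntervalParity
import Summits.CriticalPhenomena.PercolationContinuityZ3.Theorems.PercNearOneGluingNoHeavyLowerTailQ44SingleSourceCoreAR7A

/-!
# CORE A of the single-source packing from minimal-base certificates (BOT-W)

Support file for crux `stmt-CriticalPhenomena-4575` (master-family programme, row `Q44`, single-source packing
`g ≥ b1 + h_a`), seat `prim-bnk-1` gen 31; memo `run/shared/lean/prim/prim-l12/FROM-prim-bnk-1-gen31-INTERVAL-PARITY.md`.

The minimal-base certificate of `…Q44IntervalParity` (`IntervalParity.exists_odd_good_of_minimal_base`: `S₀` a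
`⊆`-minimal member, `Q ⊇ S₀` with `S₀ ∪ (Q \ S)` good for every member `S ⊆ Q`) applied to graph fibres:

* `exists_odd_good_abFamily` — every nonempty family of `K1[ab|cy]/K2[ab|cy]/K4[ab]`-sides has an odd target
  (minimum-size member, `Q = M`: `S₀ ∪ (M \ S)` has cell `abcy` and cocell `⊥` by two tables; no lobe needed);
* `exists_odd_good_fourType_of_botW` — under

  **(BOT-W)** for every `K4s[ay|bc]`-side `W` there is a set `Q`, `W ⊆ Q ⊆ M`, such that `W ∪ (Q \ S)` is a thin good
  (cell `ab|cy` or `abcy`, cocell `⊥`) for every side `S ⊆ Q` of the four core types,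

  every nonempty four-type family has an odd target: a minimum-size `K4s`-member is `⊆`-minimal in the whole family
  because no `ab`-side lies inside a `K4s`-side (`abType_not_ple_eight`);
* `exists_odd_good_coreA_of_botW`, `pack_singleSource_of_botW_coreB` — CORE A, and the full single-source law on `Fin n`
  from (BOT-W) in lobed fibres plus CORE B (via `exists_odd_good_coreA_of_fourType`, `pack_singleSource_of_cores`).

Census (memo §2, kit job of gen 31): (BOT-W) holds for every `K4s`-side of every lobed fibre on all dense templates of
gens 29–30 (several thousand sides, the natural choices `Q = W ∪ (cy-cluster of M \ W)` or `Q = M` minus the `a`- and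
`b`-clusters of `M \ W` almost always work); the only exceptions found are `u–y` double-edge fibres such as
`{wy, uy, uy′, bv, cb, vw, yc, wa, cv, au}` (3 of 24 sides), where four-type full rank still holds.  (BOT-W) is therefore
recorded as a hypothesis, like (R7-A) of `…Q44SingleSourceCoreAR7A`, which it sharpens (per side, no family quantifier).
No sorries, no definitions, standard axioms.
-/

namespace Summit.CriticalPhenomena.PercolationContinuityZ3.Theorems

namespace IntervalParity

open Finset

/-- **General interval certificate (any base).**  `𝔊` an up-set, `𝒮` a family, `P ⊆ Q`.  Group the members `S ⊆ Q` by
`S ∪ P`; if some class is odd, and `P ∪ (Q \ S)` is a good for every member `S ⊆ Q` whose class is odd, then some good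
contains an odd number of members.  (`exists_odd_good_of_minimal_base` is the case `P = S₀` a `⊆`-minimal member; the
census of the memo uses `P = S₀ ∪ S₁` for two minimal members.) [this work] -/
theorem exists_odd_good_of_base {α : Type*} [DecidableEq α] [Fintype α] (𝔊 : Finset (Finset α))
    (hG : IsUpperSet (𝔊 : Set (Finset α))) (𝒮 : Finset (Finset α)) (P Q : Finset α) (hPQ : P ⊆ Q)
    (hodd : ∃ S₁ ∈ 𝒮, S₁ ⊆ Q ∧ Odd #((𝒮.filter (fun S => S ⊆ Q)).filter (fun S => S ∪ P = S₁ ∪ P)))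
    (hval : ∀ S ∈ 𝒮, S ⊆ Q → Odd #((𝒮.filter (fun S' => S' ⊆ Q)).filter (fun S' => S' ∪ P = S ∪ P)) →
      P ∪ (Q \ S) ∈ 𝔊) :
    ∃ T ∈ 𝔊, Odd #(𝒮.filter (fun S => S ⊆ T)) := by
  classical
  set 𝒱 : Finset (Finset α) := 𝔊.filter (fun T => P ⊆ T ∧ T ⊆ Q) with h𝒱def
  -- keep only the members of odd classes: the others cancel in every count below a `T ⊇ P`
  set 𝒴 : Finset (Finset α) := (𝒮.filter (fun S => S ⊆ Q)).filter
      (fun S => Odd #((𝒮.filter (fun S' => S' ⊆ Q)).filter (fun S' => S' ∪ P = S ∪ P))) with h𝒴def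
  have h𝒱 : ∀ T ∈ 𝒱, P ⊆ T ∧ T ⊆ Q := fun T hT => (Finset.mem_filter.1 hT).2
  have hup : ∀ T ∈ 𝒱, ∀ T' : Finset α, T ⊆ T' → T' ⊆ Q → T' ∈ 𝒱 := by
    intro T hT T' hTT' hT'Q
    rw [Finset.mem_filter] at hT ⊢
    exact ⟨hG hTT' hT.1, hT.2.1.trans hTT', hT'Q⟩
  have h𝒴 : ∀ Y ∈ 𝒴, Y ⊆ Q ∧ P ∪ (Q \ Y) ∈ 𝒱 := by
    intro Y hY
    rw [h𝒴def, Finset.mem_filter, Finset.mem_filter] at hY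
    refine ⟨hY.1.2, Finset.mem_filter.2 ⟨hval Y hY.1.1 hY.1.2 hY.2, Finset.subset_union_left, ?_⟩⟩
    exact Finset.union_subset hPQ Finset.sdiff_subset
  obtain ⟨S₁, hS₁, hS₁Q, hS₁odd⟩ := hodd
  -- the class of `S₁` inside `𝒴` is the whole class of `S₁` (all its members have the same, odd, class)
  have hclass : ∀ X : Finset α, 𝒴.filter (fun Y => Y ∪ P = X) =
      if Odd #((𝒮.filter (fun S' => S' ⊆ Q)).filter (fun S' => S' ∪ P = X)) then
        (𝒮.filter (fun S' => S' ⊆ Q)).filter (fun S' => S' ∪ P = X) else ∅ := by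
    intro X
    split_ifs with hX
    · ext S
      simp only [h𝒴def, Finset.mem_filter]
      constructor
      · rintro ⟨⟨h1, _⟩, h3⟩; exact ⟨h1, h3⟩
      · rintro ⟨h1, h3⟩
        refine ⟨⟨h1, ?_⟩, h3⟩
        have : (𝒮.filter (fun S' => S' ⊆ Q)).filter (fun S' => S' ∪ P = S ∪ P) =
            (𝒮.filter (fun S' => S' ⊆ Q)).filter (fun S' => S' ∪ P = X) := by rw [h3]
        rw [this]; exact hX
    · rw [Finset.filter_eq_empty_iff]
      intro S hS h3
      rw [h𝒴def, Finset.mem_filter] at hS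
      have : (𝒮.filter (fun S' => S' ⊆ Q)).filter (fun S' => S' ∪ P = S ∪ P) =
          (𝒮.filter (fun S' => S' ⊆ Q)).filter (fun S' => S' ∪ P = X) := by rw [h3]
      rw [this] at hS
      exact hX hS.2
  have hodd' : Odd #(𝒴.filter (fun Y => Y ∪ P = S₁ ∪ P)) := by
    rw [hclass, if_pos hS₁odd]; exact hS₁odd
  obtain ⟨T, hT, hTodd⟩ := exists_odd_of_interval P Q 𝒱 𝒴 (S₁ ∪ P) h𝒱 hup h𝒴 hodd'
  refine ⟨T, (Finset.mem_filter.1 hT).1, ?_⟩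
  -- members of even classes contribute evenly to `#{S ∈ 𝒮 : S ⊆ T}`; members of odd classes are exactly `𝒴`
  have hPT : P ⊆ T := (h𝒱 T hT).1
  have hTQ : T ⊆ Q := (h𝒱 T hT).2
  -- decompose both counts over the classes `X = S ∪ P`
  have hfib : ∀ (ℱ : Finset (Finset α)), (∀ S ∈ ℱ, S ⊆ Q) →
      #(ℱ.filter (fun S => S ⊆ T)) = ∑ X ∈ (ℱ.image (fun S => S ∪ P)).filter (fun X => X ⊆ T),
        #(ℱ.filter (fun S => S ∪ P = X)) := by
    intro ℱ hℱ
    rw [Finset.card_eq_sum_card_image (fun S => S ∪ P) (ℱ.filter (fun S => S ⊆ T))]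
    have himg : (ℱ.filter (fun S => S ⊆ T)).image (fun S => S ∪ P) =
        (ℱ.image (fun S => S ∪ P)).filter (fun X => X ⊆ T) := by
      ext X
      simp only [Finset.mem_image, Finset.mem_filter]
      constructor
      · rintro ⟨S, ⟨hS, hST⟩, rfl⟩; exact ⟨⟨S, hS, rfl⟩, Finset.union_subset hST hPT⟩
      · rintro ⟨⟨S, hS, rfl⟩, hXT⟩; exact ⟨S, ⟨hS, Finset.subset_union_left.trans hXT⟩, rfl⟩
    rw [himg]
    refine Finset.sum_congr rfl fun X hX => ?_
    have hXT : X ⊆ T := (Finset.mem_filter.1 hX).2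
    congr 1
    ext S
    simp only [Finset.mem_filter]
    constructor
    · rintro ⟨⟨hS, _⟩, h2⟩; exact ⟨hS, h2⟩
    · rintro ⟨hS, h2⟩; exact ⟨⟨hS, Finset.subset_union_left.trans (h2 ▸ hXT)⟩, h2⟩
  -- parity in `ZMod 2`
  have hSQ : 𝒮.filter (fun S => S ⊆ T) = (𝒮.filter (fun S => S ⊆ Q)).filter (fun S => S ⊆ T) := by
    rw [Finset.filter_filter]
    exact Finset.filter_congr fun S _ => ⟨fun h => ⟨h.trans hTQ, h⟩, fun h => h.2⟩
  rw [hSQ]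
  set ℱ := 𝒮.filter (fun S => S ⊆ Q) with hℱdef
  have hℱQ : ∀ S ∈ ℱ, S ⊆ Q := fun S hS => (Finset.mem_filter.1 hS).2
  have h𝒴Q : ∀ S ∈ 𝒴, S ⊆ Q := fun S hS => (h𝒴 S hS).1
  have h𝒴sub : 𝒴 ⊆ ℱ := Finset.filter_subset _ _
  -- cast both counts to `ZMod 2` and compare classwise
  have hcastF : ((#(ℱ.filter (fun S => S ⊆ T)) : ℕ) : ZMod 2) =
      ∑ X ∈ (ℱ.image (fun S => S ∪ P)).filter (fun X => X ⊆ T), ((#(ℱ.filter (fun S => S ∪ P = X)) : ℕ) : ZMod 2) := by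
    rw [hfib ℱ hℱQ, Nat.cast_sum]
  have hcastY : ((#(𝒴.filter (fun S => S ⊆ T)) : ℕ) : ZMod 2) =
      ∑ X ∈ (ℱ.image (fun S => S ∪ P)).filter (fun X => X ⊆ T), ((#(𝒴.filter (fun S => S ∪ P = X)) : ℕ) : ZMod 2) := by
    rw [hfib 𝒴 h𝒴Q, Nat.cast_sum]
    -- extend the index set from the image of `𝒴` to the image of `ℱ` (extra classes are empty in `𝒴`)
    apply Finset.sum_subset_zero_on_sdiff
    · intro X hX
      rw [Finset.mem_filter, Finset.mem_image] at hX ⊢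
      obtain ⟨⟨S, hS, rfl⟩, hXT⟩ := hX
      exact ⟨⟨S, h𝒴sub hS, rfl⟩, hXT⟩
    · intro X hX
      rw [Finset.mem_sdiff, Finset.mem_filter, Finset.mem_filter, Finset.mem_image, Finset.mem_image] at hX
      have hempty : 𝒴.filter (fun S => S ∪ P = X) = ∅ := by
        rw [Finset.filter_eq_empty_iff]
        intro S hS hSX
        exact hX.2 ⟨⟨S, hS, hSX⟩, hX.1.2⟩
      rw [hempty, Finset.card_empty, Nat.cast_zero]
    · intro X _; rfl
  have hclassX : ∀ X : Finset α, ((#(𝒴.filter (fun S => S ∪ P = X)) : ℕ) : ZMod 2) =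
      ((#(ℱ.filter (fun S => S ∪ P = X)) : ℕ) : ZMod 2) := by
    intro X
    rw [hclass X]
    split_ifs with hX
    · rfl
    · rw [Finset.card_empty, Nat.cast_zero, (ZMod.natCast_eq_zero_iff_even.2 (Nat.not_odd_iff_even.1 hX))]
  have hEq : ((#(ℱ.filter (fun S => S ⊆ T)) : ℕ) : ZMod 2) = ((#(𝒴.filter (fun S => S ⊆ T)) : ℕ) : ZMod 2) := by
    rw [hcastF, hcastY]
    exact Finset.sum_congr rfl fun X _ => (hclassX X).symm
  rw [← ZMod.natCast_eq_one_iff_odd, hEq, ZMod.natCast_eq_one_iff_odd]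
  exact hTodd

end IntervalParity

/-! ## Application to graph fibres: `ab`-families and (BOT-W) -/

namespace TwoCopyMono

open Finset FourPointAtoms KernelPeeling Literature.Probability.Percolation

variable {n : ℕ}

/-- Table: the join of an `ab`-cell (`ab|cy`, `ab|c|y`) with an `ab`-cocell (`ac|by`, `ay|bc`) is `abcy`. [this work] -/
theorem table_abJoin :
    ∀ q ∈ ({(11, 9), (11, 8), (6, 8)} : Finset (Fin 15 × Fin 15)),
      ∀ q' ∈ ({(11, 9), (11, 8), (6, 8)} : Finset (Fin 15 × Fin 15)),
        ∀ z : Fin 15, ple q.1 z = true → ple q'.2 z = true → z = 14 := by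
  decide +kernel

/-- Table: a cell below an `ab`-cell and below an `ab`-cocell is `⊥`. [this work] -/
theorem table_abMeet :
    ∀ q ∈ ({(11, 9), (11, 8), (6, 8)} : Finset (Fin 15 × Fin 15)),
      ∀ q' ∈ ({(11, 9), (11, 8), (6, 8)} : Finset (Fin 15 × Fin 15)),
        ∀ z : Fin 15, ple z q.1 = true → ple z q'.2 = true → z = 0 := by
  decide +kernel

/-- Membership of a thin set `U ⊆ M` in the fat goods of `κ T = ι (T ∩ M)`. [this work] -/
theorem mem_goods_of_thin (M : Finset (Sym2 (Fin n))) (ι : Finset (Sym2 (Fin n)) → Fin 15)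
    {U : Finset (Sym2 (Fin n))} (hU : U ⊆ M) (hAC : isAC (ι U)) (hbot : ι (M \ U) = 0) :
    U ∈ goods (fun T : Finset (Sym2 (Fin n)) => ι (T ∩ M)) := by
  unfold goods
  rw [Finset.mem_filter]
  refine ⟨Finset.mem_univ _, ?_, ?_⟩
  · show isAC (ι (U ∩ M))
    rw [Finset.inter_eq_left.2 hU]; exact hAC
  · show ι (Uᶜ ∩ M) = 0
    have h2 : Uᶜ ∩ M = M \ U := by
      ext e; simp [Finset.mem_sdiff, Finset.mem_inter, and_comm]
    rw [h2]; exact hbot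

/-- **`ab`-families are never bad.**  In any graph fibre, every nonempty family of sides of the types `K1[ab|cy] (11,9)`,
`K2[ab|cy] (11,8)`, `K4[ab] (6,8)` has an odd target: minimal base `S₀` (a minimum-size member) with `Q = M`, where
`S₀ ∪ (M \ S)` has cell `abcy` and cocell `⊥` by the tables. No lobe is needed. [this work] -/
theorem exists_odd_good_abFamily (a b c y : Fin n) (C M : Finset (Sym2 (Fin n)))
    (ι : Finset (Sym2 (Fin n)) → Fin 15) (hι : ∀ T : Finset (Sym2 (Fin n)), prof a b c y ↑(C ∪ T) = pp (ι T))
    (𝒮 : Finset (Finset (Sym2 (Fin n)))) (hne : 𝒮.Nonempty) (h𝒮M : ∀ S ∈ 𝒮, S ⊆ M)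
    (htypes : ∀ S ∈ 𝒮, (ι S, ι (M \ S)) ∈ ({(11, 9), (11, 8), (6, 8)} : Finset (Fin 15 × Fin 15))) :
    ∃ T ∈ goods (fun T : Finset (Sym2 (Fin n)) => ι (T ∩ M)), Odd #(𝒮.filter (fun S => S ⊆ T)) := by
  classical
  set κ : Finset (Sym2 (Fin n)) → Fin 15 := fun T => ι (T ∩ M) with hκ
  have hmono : ∀ A B : Finset (Sym2 (Fin n)), A ⊆ B → ple (κ A) (κ B) = true := fun A B hAB =>
    ple_fibreMap a b c y C ι hι (Finset.inter_subset_inter hAB (subset_refl M))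
  obtain ⟨S₀, hS₀, hS₀min⟩ := Finset.exists_min_image 𝒮 Finset.card hne
  have hmin : ∀ S ∈ 𝒮, S ⊆ S₀ → S = S₀ := fun S hS hsub =>
    Finset.eq_of_subset_of_card_le hsub (hS₀min S hS)
  refine IntervalParity.exists_odd_good_of_minimal_base (goods κ) (goods_upper κ hmono) 𝒮 S₀ M hS₀ hmin (h𝒮M S₀ hS₀) ?_
  intro S hS hSM
  have hq₀ := htypes S₀ hS₀
  have hq := htypes S hS
  refine mem_goods_of_thin M ι (Finset.union_subset (h𝒮M S₀ hS₀) Finset.sdiff_subset) ?_ ?_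
  · -- cell of `S₀ ∪ (M \ S)` is above `ι S₀` and above `ι (M \ S)`
    have h1 : ple (ι S₀) (ι (S₀ ∪ (M \ S))) = true := ple_fibreMap a b c y C ι hι Finset.subset_union_left
    have h2 : ple (ι (M \ S)) (ι (S₀ ∪ (M \ S))) = true := ple_fibreMap a b c y C ι hι Finset.subset_union_right
    exact Or.inr (table_abJoin _ hq₀ _ hq _ h1 h2)
  · -- cocell: `M \ (S₀ ∪ (M \ S)) ⊆ S` and `⊆ M \ S₀`
    have hsub1 : M \ (S₀ ∪ (M \ S)) ⊆ S := by
      intro e he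
      simp only [Finset.mem_sdiff, Finset.mem_union, not_or, not_and, not_not] at he
      exact he.2.2 he.1
    have hsub2 : M \ (S₀ ∪ (M \ S)) ⊆ M \ S₀ := by
      intro e he
      simp only [Finset.mem_sdiff, Finset.mem_union, not_or] at he ⊢
      exact ⟨he.1, he.2.1⟩
    have h1 : ple (ι (M \ (S₀ ∪ (M \ S)))) (ι S) = true := ple_fibreMap a b c y C ι hι hsub1
    have h2 : ple (ι (M \ (S₀ ∪ (M \ S)))) (ι (M \ S₀)) = true := ple_fibreMap a b c y C ι hι hsub2
    exact table_abMeet _ hq _ hq₀ _ h1 h2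

/-- **Four-type families from (BOT-W).**  Graph fibre in which every `K4s[ay|bc]`-side `W` admits a set `Q`, `W ⊆ Q ⊆ M`,
with `W ∪ (Q \ S)` a thin good for every four-type side `S ⊆ Q`.  Then every nonempty family of sides of the four core
types has an odd target: if it has a `K4s`-member, a minimum-size one is `⊆`-minimal in the family (no `ab`-side lies
inside a `K4s`-side) and `exists_odd_good_of_minimal_base` applies with its `Q`; otherwise `exists_odd_good_abFamily`.
[this work] -/
theorem exists_odd_good_fourType_of_botW (a b c y : Fin n) (C M : Finset (Sym2 (Fin n)))
    (ι : Finset (Sym2 (Fin n)) → Fin 15) (hι : ∀ T : Finset (Sym2 (Fin n)), prof a b c y ↑(C ∪ T) = pp (ι T))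
    (hbot : ∀ W : Finset (Sym2 (Fin n)), W ⊆ M → (ι W, ι (M \ W)) = (8, 1) →
      ∃ Q : Finset (Sym2 (Fin n)), W ⊆ Q ∧ Q ⊆ M ∧
        ∀ S : Finset (Sym2 (Fin n)), S ⊆ Q →
          (ι S, ι (M \ S)) ∈ ({(11, 9), (11, 8), (6, 8), (8, 1)} : Finset (Fin 15 × Fin 15)) →
          isAC (ι (W ∪ (Q \ S))) ∧ ι (M \ (W ∪ (Q \ S))) = 0)
    (𝒮 : Finset (Finset (Sym2 (Fin n)))) (hne : 𝒮.Nonempty) (h𝒮M : ∀ S ∈ 𝒮, S ⊆ M)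
    (htypes : ∀ S ∈ 𝒮, (ι S, ι (M \ S)) ∈ ({(11, 9), (11, 8), (6, 8), (8, 1)} : Finset (Fin 15 × Fin 15))) :
    ∃ T ∈ goods (fun T : Finset (Sym2 (Fin n)) => ι (T ∩ M)), Odd #(𝒮.filter (fun S => S ⊆ T)) := by
  classical
  set κ : Finset (Sym2 (Fin n)) → Fin 15 := fun T => ι (T ∩ M) with hκ
  have hmono : ∀ A B : Finset (Sym2 (Fin n)), A ⊆ B → ple (κ A) (κ B) = true := fun A B hAB =>
    ple_fibreMap a b c y C ι hι (Finset.inter_subset_inter hAB (subset_refl M))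
  have hmem4 : ∀ S ∈ 𝒮, (ι S, ι (M \ S)) ∈ ({(11, 9), (11, 8), (6, 8)} : Finset (Fin 15 × Fin 15)) ∨
      (ι S, ι (M \ S)) = (8, 1) := by
    intro S hS
    have h := htypes S hS
    simp only [Finset.mem_insert, Finset.mem_singleton] at h ⊢
    tauto
  by_cases hW : ∃ S ∈ 𝒮, (ι S, ι (M \ S)) = (8, 1)
  · -- a minimum-size `K4s`-member is `⊆`-minimal in the family
    obtain ⟨W₀, hW₀f, hW₀min⟩ := Finset.exists_min_image (𝒮.filter (fun S => (ι S, ι (M \ S)) = (8, 1)))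
      Finset.card (by obtain ⟨S, hS, hSt⟩ := hW; exact ⟨S, Finset.mem_filter.2 ⟨hS, hSt⟩⟩)
    have hW₀ : W₀ ∈ 𝒮 := (Finset.mem_filter.1 hW₀f).1
    have hW₀t : (ι W₀, ι (M \ W₀)) = (8, 1) := (Finset.mem_filter.1 hW₀f).2
    have hW₀8 : ι W₀ = 8 := (Prod.mk.injEq _ _ _ _ ▸ hW₀t : ι W₀ = 8 ∧ ι (M \ W₀) = 1).1
    have hmin : ∀ S ∈ 𝒮, S ⊆ W₀ → S = W₀ := by
      intro S hS hsub
      rcases hmem4 S hS with hSab | hSW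
      · exfalso
        have hle : ple (ι S) (ι W₀) = true := ple_fibreMap a b c y C ι hι hsub
        rw [hW₀8] at hle
        have hf := abType_not_ple_eight _ hSab
        rw [hle] at hf
        exact Bool.noConfusion hf
      · exact Finset.eq_of_subset_of_card_le hsub (hW₀min S (Finset.mem_filter.2 ⟨hS, hSW⟩))
    obtain ⟨Q, hW₀Q, hQM, hQ⟩ := hbot W₀ (h𝒮M W₀ hW₀) hW₀t
    refine IntervalParity.exists_odd_good_of_minimal_base (goods κ) (goods_upper κ hmono) 𝒮 W₀ Q hW₀ hmin hW₀Q ?_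
    intro S hS hSQ
    obtain ⟨hAC, hbt⟩ := hQ S hSQ (htypes S hS)
    exact mem_goods_of_thin M ι (Finset.union_subset (h𝒮M W₀ hW₀) (Finset.sdiff_subset.trans hQM)) hAC hbt
  · -- no `K4s`-member: an `ab`-family
    have hab : ∀ S ∈ 𝒮, (ι S, ι (M \ S)) ∈ ({(11, 9), (11, 8), (6, 8)} : Finset (Fin 15 × Fin 15)) := by
      intro S hS
      rcases hmem4 S hS with h | h
      · exact h
      · exact absurd ⟨S, hS, h⟩ hW
    exact exists_odd_good_abFamily a b c y C M ι hι 𝒮 hne h𝒮M hab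

/-- **CORE A from (BOT-W).**  In a graph fibre satisfying (BOT-W), every seven-type family containing a `K4[ab]`- and a
`K4s[ay|bc]`-side and not lying in CORE B has an odd target. [this work] -/
theorem exists_odd_good_coreA_of_botW (a b c y : Fin n) (C M : Finset (Sym2 (Fin n)))
    (ι : Finset (Sym2 (Fin n)) → Fin 15) (hι : ∀ T : Finset (Sym2 (Fin n)), prof a b c y ↑(C ∪ T) = pp (ι T))
    (hbot : ∀ W : Finset (Sym2 (Fin n)), W ⊆ M → (ι W, ι (M \ W)) = (8, 1) →
      ∃ Q : Finset (Sym2 (Fin n)), W ⊆ Q ∧ Q ⊆ M ∧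
        ∀ S : Finset (Sym2 (Fin n)), S ⊆ Q →
          (ι S, ι (M \ S)) ∈ ({(11, 9), (11, 8), (6, 8), (8, 1)} : Finset (Fin 15 × Fin 15)) →
          isAC (ι (W ∪ (Q \ S))) ∧ ι (M \ (W ∪ (Q \ S))) = 0)
    (𝒮 : Finset (Finset (Sym2 (Fin n)))) (h𝒮M : ∀ S ∈ 𝒮, S ⊆ M)
    (htypes : ∀ S ∈ 𝒮, (ι S, ι (M \ S)) ∈
      ({(6, 7), (5, 7), (11, 9), (11, 8), (6, 8), (6, 1), (8, 1)} : Finset (Fin 15 × Fin 15)))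
    (hA : (∃ S ∈ 𝒮, (ι S, ι (M \ S)) = (6, 8)) ∧ (∃ S ∈ 𝒮, (ι S, ι (M \ S)) = (8, 1)))
    (hB : ¬ ((∃ S ∈ 𝒮, (ι S, ι (M \ S)) = (5, 7)) ∧ (∃ S ∈ 𝒮, (ι S, ι (M \ S)) = (11, 9)) ∧
      (∃ S ∈ 𝒮, (ι S, ι (M \ S)) = (6, 1) ∨ (ι S, ι (M \ S)) = (6, 8)))) :
    ∃ T ∈ goods (fun T : Finset (Sym2 (Fin n)) => ι (T ∩ M)), Odd #(𝒮.filter (fun S => S ⊆ T)) :=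
  exists_odd_good_coreA_of_fourType a b c y C M ι hι
    (fun 𝒮' hne' h𝒮M' htypes' => exists_odd_good_fourType_of_botW a b c y C M ι hι hbot 𝒮' hne' h𝒮M' htypes')
    𝒮 h𝒮M htypes hA hB

/-- **The full single-source packing from (BOT-W) and CORE B, all `n`.**  If, for the marked points `a b c y` of `Fin n`,
in every graph fibre with an `a`-lobe (i) (BOT-W) holds — every `K4s[ay|bc]`-side `W` has a set `Q`, `W ⊆ Q ⊆ M`, with
`W ∪ (Q \ S)` a thin good for every four-type side `S ⊆ Q` — and (ii) every CORE-B family has an odd target, then on every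
finite weighted graph on `Fin n`:
`P(ab|c|y)P(a|bcy) + P(ac|b|y)P(a|bcy) + P(ab|cy)P(ac|by) + P(ab|cy)P(ay|bc) + P(ab|c|y)P(ay|bc) + P(ab|c|y)P(a|b|cy) + P(ay|bc)P(a|b|cy)
 ≤ [P(ab|cy)+P(abcy)]·P(a|b|c|y)`. [this work] -/
theorem pack_singleSource_of_botW_coreB (a b c y : Fin n)
    (hbotW : ∀ (M C : Finset (Sym2 (Fin n))) (ι : Finset (Sym2 (Fin n)) → Fin 15),
      (∀ T : Finset (Sym2 (Fin n)), prof a b c y ↑(C ∪ T) = pp (ι T)) →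
      (∃ T ∈ M.powerset, (ι T, ι (M \ T)) ∈ ({(6, 7), (5, 7)} : Finset (Fin 15 × Fin 15))) →
      ∀ W : Finset (Sym2 (Fin n)), W ⊆ M → (ι W, ι (M \ W)) = (8, 1) →
        ∃ Q : Finset (Sym2 (Fin n)), W ⊆ Q ∧ Q ⊆ M ∧
          ∀ S : Finset (Sym2 (Fin n)), S ⊆ Q →
            (ι S, ι (M \ S)) ∈ ({(11, 9), (11, 8), (6, 8), (8, 1)} : Finset (Fin 15 × Fin 15)) →
            isAC (ι (W ∪ (Q \ S))) ∧ ι (M \ (W ∪ (Q \ S))) = 0)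
    (hcoreB : ∀ (M C : Finset (Sym2 (Fin n))) (ι : Finset (Sym2 (Fin n)) → Fin 15),
      (∀ T : Finset (Sym2 (Fin n)), prof a b c y ↑(C ∪ T) = pp (ι T)) →
      (∃ T ∈ M.powerset, (ι T, ι (M \ T)) ∈ ({(6, 7), (5, 7)} : Finset (Fin 15 × Fin 15))) →
      ∀ 𝒮 : Finset (Finset (Sym2 (Fin n))), 𝒮.Nonempty → (∀ S ∈ 𝒮, S ⊆ M) →
        (∀ S ∈ 𝒮, (ι S, ι (M \ S)) ∈ ({(6, 7), (5, 7), (11, 9), (11, 8), (6, 8), (6, 1), (8, 1)} : Finset (Fin 15 × Fin 15))) →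
        ((∃ S ∈ 𝒮, (ι S, ι (M \ S)) = (5, 7)) ∧ (∃ S ∈ 𝒮, (ι S, ι (M \ S)) = (11, 9)) ∧
          (∃ S ∈ 𝒮, (ι S, ι (M \ S)) = (6, 1) ∨ (ι S, ι (M \ S)) = (6, 8))) →
        ∃ T ∈ goods (fun T : Finset (Sym2 (Fin n)) => ι (T ∩ M)), Odd #(𝒮.filter (fun S => S ⊆ T)))
    (w : Sym2 (Fin n) → unitInterval) :
    cell w a b c y 6 * cell w a b c y 7 +
      cell w a b c y 5 * cell w a b c y 7 +
      cell w a b c y 11 * cell w a b c y 9 +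
      cell w a b c y 11 * cell w a b c y 8 +
      cell w a b c y 6 * cell w a b c y 8 +
      cell w a b c y 6 * cell w a b c y 1 +
      cell w a b c y 8 * cell w a b c y 1 ≤
      (cell w a b c y 11 + cell w a b c y 14) * cell w a b c y 0 := by
  refine pack_singleSource_of_cores a b c y (fun M C ι hι hlobe 𝒮 hne h𝒮M htypes hcore => ?_) w
  by_cases hB : (∃ S ∈ 𝒮, (ι S, ι (M \ S)) = (5, 7)) ∧ (∃ S ∈ 𝒮, (ι S, ι (M \ S)) = (11, 9)) ∧
      (∃ S ∈ 𝒮, (ι S, ι (M \ S)) = (6, 1) ∨ (ι S, ι (M \ S)) = (6, 8))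
  · exact hcoreB M C ι hι hlobe 𝒮 hne h𝒮M htypes hB
  · rcases hcore with hA | hB'
    · exact exists_odd_good_coreA_of_botW a b c y C M ι hι (hbotW M C ι hι hlobe) 𝒮 h𝒮M htypes hA hB
    · exact absurd hB' hB

end TwoCopyMono

end Summit.CriticalPhenomena.PercolationContinuityZ3.Theorems
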